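import Summits.CriticalPhenomena.PercolationContinuityZ3.Theorems.PercNearOneGluingNoHeavyLowerTailSahiPair43LinkNode
import Summits.CriticalPhenomena.PercolationContinuityZ3.Theorems.PercNearOneGluingNoHeavyLowerTailSahiPair43LinkSym

/-!
# `NoHeavyLowerTail` (crux stmt-CriticalPhenomena-4575), Sahi programme: the cell `(4,3)` — **link, final**: `PatternPos 4` from the
# chunk checks

Support file (Sahi cell `prim-sahi`, seat `prim-sahi-typer` gen 32; `--supports stmt-CriticalPhenomena-4575`).  Pure proofs; no `sorry`,
standard axioms.

* `inDual_of_coGen_empty` (no co-generators: both sets are everything), `inDual_of_sorted` (sorted signature: served by the checker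
  directly or after swapping the two sets);
* **`inDual_of_pairCond_of_chunks`**: if `chunkCheck m r = true` for all `r < m` (`0 < m`), every pair satisfying `PairCond` has its
  y-profile in the dual cone of the up-sets (sort the signature by `Tuple.sort`, transport along the axis permutation);
* **`patternPos_four_of_chunks`**: hence `PatternPos 4` (`patternPos_of_pairCond` of `…SahiPairSaturation`).
The twenty evaluations `chunkCheck 20 r = true` are the computational companion files `…SahiPair43Chunk<r>`; the unconditional
assembly is `…SahiPatternPosFour`. [this work]
-/

namespace Summit.CriticalPhenomena.PercolationContinuityZ3.Theorems.SahiGridPattern.Pair43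

open Finset SahiGrid3 SahiGridPattern
open scoped BigOperators

/-! ### The final assembly -/

/-- A pair with no co-generators at all: both sets are everything, and the profile is pointwise nonnegative. [this work] -/
theorem inDual_of_coGen_empty {A B : Finset (Pd 4)} (h : PairCond A B) (hN : coGen A ∪ coGen B = ∅) : InDual (yProfile A B) := by
  have hA : A = univ := eq_univ_of_coGen_eq_empty h.upA (Finset.union_eq_empty.1 hN).1
  have hB : B = univ := eq_univ_of_coGen_eq_empty h.upB (Finset.union_eq_empty.1 hN).2
  subst hA; subst hB
  exact inDual_of_nonneg fun y => yProfile_nonneg_of_mem (by simp)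

/-- A pair whose node has sorted signature: served by the checker directly or after swapping the two sets. [this work] -/
theorem inDual_of_sorted {m : ℕ} (hm : 0 < m) (hc : ∀ r < m, chunkCheck m r = true) {A B : Finset (Pd 4)} (h : PairCond A B)
    (hne : (coGen A ∪ coGen B).Nonempty)
    (hsig : sigP 0 (coGen A ∪ coGen B) ≤ sigP 1 (coGen A ∪ coGen B) ∧ sigP 1 (coGen A ∪ coGen B) ≤ sigP 2 (coGen A ∪ coGen B) ∧
      sigP 2 (coGen A ∪ coGen B) ≤ sigP 3 (coGen A ∪ coGen B)) : InDual (yProfile A B) := by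
  have hr := hc _ (Nat.mod_lt (ptsHash (nodeList (coGen A ∪ coGen B)).toArray) hm)
  -- the lowest code of the node is a co-generator of `A` or of `B`
  have h0 : (nodeList (coGen A ∪ coGen B)).getD 0 0 ∈ codes (coGen A ∪ coGen B) :=
    getD_nodeList_mem (by rw [length_nodeList]; exact card_pos.2 hne)
  obtain ⟨x, hx, hxe⟩ := mem_codes.1 h0
  rcases mem_union.1 hx with hxA | hxB
  · exact inDual_of_node h hr hne (by rw [← hxe]; exact enc_mem_codes.2 hxA) hsig rfl
  · -- swap the two sets: same node, lowest code now in the first class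
    apply inDual_swap
    have h' := pairCond_swap h
    have hU : coGen B ∪ coGen A = coGen A ∪ coGen B := union_comm _ _
    have hr' : chunkCheck m (ptsHash (nodeList (coGen B ∪ coGen A)).toArray % m) = true := by rw [hU]; exact hr
    refine inDual_of_node h' hr' (by rw [hU]; exact hne) ?_ (by rw [hU]; exact hsig) rfl
    rw [hU, ← hxe]; exact enc_mem_codes.2 hxB

/-- **Every pair satisfying `PairCond` has its y-profile in the dual cone**, given the chunk checks: sort the signature by an axis
permutation (`Tuple.sort`), apply `inDual_of_sorted` to the image pair, transport back. [this work] -/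
theorem inDual_of_pairCond_of_chunks {m : ℕ} (hm : 0 < m) (hc : ∀ r < m, chunkCheck m r = true) {A B : Finset (Pd 4)}
    (h : PairCond A B) : InDual (yProfile A B) := by
  by_cases hN : coGen A ∪ coGen B = ∅
  · exact inDual_of_coGen_empty h hN
  · -- sort the signature
    let f : Fin 4 → ℕ := fun a => sigP a (coGen A ∪ coGen B)
    let τ : Equiv.Perm (Fin 4) := Tuple.sort f
    have hmono : Monotone (f ∘ τ) := Tuple.monotone_sort f
    apply inDual_of_map τ
    have h' := pairCond_map τ h
    have hN' : coGen (A.map (compEquivD τ).toEmbedding) ∪ coGen (B.map (compEquivD τ).toEmbedding) =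
        (coGen A ∪ coGen B).map (compEquivD τ).toEmbedding := by
      rw [coGen_map, coGen_map, Finset.map_union]
    refine inDual_of_sorted hm hc h' ?_ ?_
    · rw [hN']; exact (Finset.map_nonempty.2 (Finset.nonempty_iff_ne_empty.2 hN))
    · rw [hN']
      have e : ∀ a : Fin 4, sigP a ((coGen A ∪ coGen B).map (compEquivD τ).toEmbedding) = (f ∘ τ) a := fun a => sigP_map τ a _
      have e0 := e 0; have e1 := e 1; have e2 := e 2; have e3 := e 3
      simp only [Fin.val_zero, Fin.val_one, Fin.val_two] at e0 e1 e2
      have h3 : ((3 : Fin 4) : ℕ) = 3 := rfl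
      rw [h3] at e3
      rw [e0, e1, e2, e3]
      exact ⟨hmono (by decide), hmono (by decide), hmono (by decide)⟩

/-- **THE CELL `(4,3)` FROM THE CHUNK CHECKS**: if every chunk of the pair-saturation check passes then `PatternPos 4`. [this work] -/
theorem patternPos_four_of_chunks {m : ℕ} (hm : 0 < m) (hc : ∀ r < m, chunkCheck m r = true) : PatternPos 4 :=
  patternPos_of_pairCond fun _ _ h => inDual_of_pairCond_of_chunks hm hc h

end Summit.CriticalPhenomena.PercolationContinuityZ3.Theorems.SahiGridPattern.Pair43
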